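import Literature.MathematicalPhysics.QuantumFieldTheory.Balaban1983to89.B9Thm313WholeLeafRelS
import Literature.MathematicalPhysics.QuantumFieldTheory.Balaban1983to89.B9Thm313WholeHolder

/-!
# `Balaban1983to89.B9Thm313WholeLeafRelSH` — [B9] Theorem 3.13 (p. 426) AS THE WHOLE PRINTED LEAF `B9.Thm313Printed` AT THE PINS OF THEOREM 3.12 — the
# row-21 leaf with (3.46)₀,₁,₂ AND THE (3.43) LINE of 𝔊 PROVED INSIDE; the residual is three L² lines and the two input-Hölder lines

T. Bałaban, *Propagators for lattice gauge theories in a background field*, Commun. Math. Phys. **99** (1985) 389–434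
[`Balaban1985BackgroundPropagators`, "B9"]; [4] = T. Bałaban, *Propagators and renormalization transformations for lattice
gauge theories. II*, Commun. Math. Phys. **96** (1984) 223–250 [`Balaban1984PropagatorsII`].

statement-level skeleton of published theorems with citation tags; proofs where landed; nothing here is a claim about the
Yang–Mills mass gap

THE PRINTED LOCI are those of `…B9Thm313WholeLeafCoGlob`, `…B9Thm312WholeL2` and `…B9Thm313WholeHolder` (verbatim there).

WHY THIS FILE (successor of `…B9Thm313WholeLeafRelS.thm313Printed_of_stepRelS`, same seat).  The (3.43) line of 𝔊 — the max of ‖ζ∇_U𝔊λ‖_β and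
‖ζ𝔊∇\*_Uλ‖_β, read through the probes (n06-k `H1ReadsRel`) — is PROVED INSIDE from the two probe majorants of `B9Thm313WholeHolder.GG_probe43L_of_letters`
∕ `GG_probe43R_of_letters` ((3.153) carried out in the probe classes: letters `Letters313`, `Letters313D.rgdH`, `LettersHH.pQ`, `Letters313H`, Theorem 3.3's
(3.43) probes for G₀ `Thm33G0H.h43L∕h43R`, the Hölder step `StepH.pY1∕pX1`) and n06-k's `line343_of_hasMajorantHom_rel`.  The residual keeps the lines
(3.46)₃,₄,₅ (`hres.1`), (3.44) (`E4Block`) and (3.45) (`H2Block`) of 𝔊.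

WHAT THIS FILE PROVES (one public theorem + three private bookkeeping lemmas — 0 `def`, 0 named fact, 0 sorry): ★ `thm313Printed_of_stepRelSH` —
conclusion and pins of row 21 unchanged.

HONEST SCOPE.  Nothing of print is asserted: every analytic input is a HYPOTHESIS of printed ∕ definitional shape (located gap G-B9-16).  Kernel-checked
bookkeeping — NOT a node discharge, NOT summit progress; one finite lattice at a time; nothing continuum, nothing about the mass gap.  Cell `pub-ymgap`
(HUMAN RULING D-0062), Track A node N06 [B9], N06-ASSIGNMENT v1 row 21 (bundle F7), seat `pub-ymgap-dag-n06-l` (g4), 2026-08-27.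
-/

namespace Literature.MathematicalPhysics.QuantumFieldTheory.Balaban1983to89.B9Thm313WholeLeafRelSH

open Literature.MathematicalPhysics.QuantumFieldTheory.Balaban1983to89
open Finset B6RandomWalk B6RandomWalkHom B9Thm34Ext B9Thm37GlueCor36 B11SectG B9SectDSup
open B9Thm37AllNorms B9Thm37AllNormsInstances B9FromB6 B9FromB6ModelSignsOn B9SectBStepWhole B9Thm312Whole B9Thm312WholeLeaf
open B9Thm312WholeLeft B9Thm313Whole B9Thm313WholeLeft B9Thm312WholeLeafLeftGlob B9Ineq347CoReading B9SectCDiffDict B9CoRealizesRel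
open B9Thm37Glue B9SectDL2Decay B9RWSums343Holder B9RWSumsReadsRel B9Ineq347 B9Thm312WholeClasses B9Thm312WholeL2 B9Thm312WholeBlocksRel
open B9Thm313WholeLeafRel B9Thm312WholeHolder B9Thm312WholeHHolder B9Thm313WholeHolder B9Thm313WholeLeafRelS

noncomputable section

section Family

variable {I : Type} {c35 : ℝ} {geo : I → B9.Geometry} {bg : I → B9.Backgrounds}
variable [∀ i, Fintype (geo i).Site] [∀ i, DecidableEq (geo i).Site]
variable {X Y Z W PX PY : I → Type} [∀ i, Fintype (X i)] [∀ i, DecidableEq (X i)] [∀ i, Fintype (Y i)]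
  [∀ i, Fintype (Z i)] [∀ i, Fintype (W i)] [∀ i, Fintype (PX i)] [∀ i, Fintype (PY i)]

omit [∀ i, Fintype (X i)] [∀ i, DecidableEq (X i)] [∀ i, Fintype (Y i)] [∀ i, Fintype (Z i)] [∀ i, Fintype (W i)]
  [∀ i, Fintype (geo i).Site] [∀ i, DecidableEq (geo i).Site] [∀ i, Fintype (PX i)] [∀ i, Fintype (PY i)] in
/-- Arithmetic of *"for α₀ sufficiently small"*: t ≧ 0 and m ≦ (2(t + 1))⁻¹ give tm ≦ ½. [folklore] -/
private theorem small_aux₇ {t m : ℝ} (ht : 0 ≤ t) (hm : m ≤ (2 * (t + 1))⁻¹) : t * m ≤ 1 / 2 := by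
  have hpos : 0 < 2 * (t + 1) := by linarith
  have h1 : t * m ≤ t * (2 * (t + 1))⁻¹ := mul_le_mul_of_nonneg_left hm ht
  have h2 : t * (2 * (t + 1))⁻¹ ≤ 1 / 2 := by
    rw [← div_eq_mul_inv, div_le_iff₀ hpos]
    linarith
  linarith


omit [∀ i, Fintype (X i)] [∀ i, DecidableEq (X i)] [∀ i, Fintype (Y i)] [∀ i, Fintype (Z i)] [∀ i, Fintype (W i)]
  [∀ i, Fintype (geo i).Site] [∀ i, DecidableEq (geo i).Site] [∀ i, Fintype (PX i)] [∀ i, Fintype (PY i)] in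
/-- The six (3.46) lines from the three proved ones (n = 0, 1, 2) and the three displayed ones (n ≧ 3) (the bookkeeping of n06-k's
`B9RWSums346Schur`). [cite: Balaban1985BackgroundPropagators, (3.46) p.398 (bookkeeping)] -/
private theorem l2Block_of_split' {i : I} {K : B9.KernelFamily (geo i) (bg i)} {U : (bg i).Cfg} {B₀ δ₀ : ℝ}
    (h0 : ∀ (lam : (geo i).Loc) (h : (geo i).Cut) (y y' : (geo i).Site), (geo i).cutIn h y → (geo i).suppIn lam y' →
      K.l2 0 U lam h ≤ B₀ * B9.pref6 ((geo i).len y) 0 * (geo i).cutSup h * Real.exp (-(δ₀ * (geo i).dist y y')) * (geo i).l2Norm lam)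
    (h1 : ∀ (lam : (geo i).Loc) (h : (geo i).Cut) (y y' : (geo i).Site), (geo i).cutIn h y → (geo i).suppIn lam y' →
      K.l2 1 U lam h ≤ B₀ * B9.pref6 ((geo i).len y) 1 * (geo i).cutSup h * Real.exp (-(δ₀ * (geo i).dist y y')) * (geo i).l2Norm lam)
    (h2 : ∀ (lam : (geo i).Loc) (h : (geo i).Cut) (y y' : (geo i).Site), (geo i).cutIn h y → (geo i).suppIn lam y' →
      K.l2 2 U lam h ≤ B₀ * B9.pref6 ((geo i).len y) 2 * (geo i).cutSup h * Real.exp (-(δ₀ * (geo i).dist y y')) * (geo i).l2Norm lam)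
    (h345 : ∀ (n : Fin 6), 3 ≤ n.val → ∀ (lam : (geo i).Loc) (h : (geo i).Cut) (y y' : (geo i).Site), (geo i).cutIn h y →
      (geo i).suppIn lam y' →
      K.l2 n U lam h ≤ B₀ * B9.pref6 ((geo i).len y) n * (geo i).cutSup h * Real.exp (-(δ₀ * (geo i).dist y y')) * (geo i).l2Norm lam) :
    L2Block K B₀ δ₀ U := by
  intro n
  fin_cases n
  · exact h0
  · exact h1
  · exact h2
  · exact h345 3 (by decide)
  · exact h345 4 (by decide)
  · exact h345 5 (by decide)


omit [∀ i, Fintype (X i)] [∀ i, DecidableEq (X i)] [∀ i, Fintype (Y i)] [∀ i, Fintype (Z i)] [∀ i, Fintype (W i)]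
  [∀ i, Fintype (geo i).Site] [∀ i, DecidableEq (geo i).Site] [∀ i, Fintype (PX i)] [∀ i, Fintype (PY i)] in
/-- `constH313` is monotone in every constant but B₃, c (for non-negative data). [cite: Balaban1985BackgroundPropagators, Thm 3.13 p.426 (bookkeeping)] -/
private theorem constH313_mono' {CL CL' θ' θ'' A₁ A₁' A₃ A₃' B₃ Bd Bd' Bq Bq' κW κW' c : ℝ} (hL' : CL ≤ CL') (hθ : 0 ≤ θ')
    (hθ'' : θ' ≤ θ'') (h₁ : 0 ≤ A₁) (h₁' : A₁ ≤ A₁') (h₃ : 0 ≤ A₃) (h₃' : A₃ ≤ A₃') (hB : 0 ≤ B₃) (hd : 0 ≤ Bd) (hd' : Bd ≤ Bd')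
    (hq : 0 ≤ Bq) (hq' : Bq ≤ Bq') (hκ : 0 ≤ κW) (hκ' : κW ≤ κW') (hc : 0 ≤ c) :
    constH313 CL θ' A₁ A₃ B₃ Bd Bq κW c ≤ constH313 CL' θ'' A₁' A₃' B₃ Bd' Bq' κW' c := by
  unfold constH313
  have hθ''0 : 0 ≤ θ'' := hθ.trans hθ''
  have hA₃'0 : 0 ≤ A₃' := h₃.trans h₃'
  have hd'0 : 0 ≤ Bd' := hd.trans hd'
  have hκ'0 : 0 ≤ κW' := hκ.trans hκ'
  have hq'0 : 0 ≤ Bq' := hq.trans hq'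
  have e2 : κW * Bd * B₃ * c ≤ κW' * Bd' * B₃ * c := by gcongr
  have e3 : θ' * (A₃ * B₃ * c) * c ≤ θ'' * (A₃' * B₃ * c) * c := by gcongr
  have e4 : Bq * (B₃ * (B₃ * A₁ * c) * c) * c ≤ Bq' * (B₃ * (B₃ * A₁' * c) * c) * c := by gcongr
  have e5 : θ' * (A₃ * (B₃ * (B₃ * A₁ * c) * c) * c) * c ≤ θ'' * (A₃' * (B₃ * (B₃ * A₁' * c) * c) * c) * c := by gcongr
  linarith

-- heartbeat budget (v1.1, pre-emptive): this one-block proof elaborates at ≈ 130–160k heartbeats on the farm — the band in which two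
-- sibling leaves failed `lake build` at the 200k default (2026-08-27); statement and proof byte-identical to v1.
set_option maxHeartbeats 400000 in
/-- ★ **THEOREM 3.13 AS THE WHOLE PRINTED LEAF `B9.Thm313Printed`, AT THE PINS OF THEOREM 3.12 — (3.46)₀,₁,₂ AND (3.43) OF 𝔊 PROVED INSIDE** (p. 426).
Inputs: those of `B9Thm313WholeLeafRelS.thm313Printed_of_stepRelS` plus the probe letters `𝔭 i` and input norms `bHY i` (as row 20), Theorem 3.3's Hölder
probes for G₀ (`hG0H : Thm33G0H …`), the Hölder steps (`hstepH : StepH … (θ_H·(Mα₀)) …`), the probe letters `hLHH : LettersHH …` (Φ^Y∇G₀Q*) and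
`hLH3 : Letters313H … (bH i) BhD Bx δ₃ U` (Φ^Y∇G₀D out of the scalar Hölder class, Φ^XG₀D, Φ^XG₀Q*), the relative probe co-reading `hH1R : H1ReadsRel (GG i) …`,
constants `θH Bh Bi Bi2 Bq BhD Bx`; `hres` now displays ONLY the lines (3.46)ₙ, n ≧ 3, (3.44) (`E4Block`) and (3.45) (`H2Block`) of 𝔊.  PROVED INSIDE:
(3.42)₁,₂,₃, (3.46)₀,₁,₂, (3.43) (through `GG_probe43L∕R_of_letters` + `line343_of_hasMajorantHom_rel`, constant m·`constH313` uniformised), (3.47)₀,₁,₂ of 𝔊,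
the pins.  Nothing of print asserted; NOT a node discharge.
[cite: Balaban1985BackgroundPropagators, Thm 3.13 p.426 + (3.152)–(3.153) p.426 + (3.138) p.423 + (3.41)–(3.43) pp.397–398 + (3.46)–(3.47) p.398; Balaban1984PropagatorsII, (2.51)–(2.52) p.232 + Lemma 2.1 (2.60)–(2.61) p.234] -/
theorem thm313Printed_of_stepRelSH (𝔬 : ∀ i, Ops (geo i) (bg i) (X i) (Y i) (Z i) (W i)) (R₀ : I → ℝ) (H₀ : I → Prop)
    (GG : ∀ i, B9.KernelFamily (geo i) (bg i)) (bH : ∀ i, BlockNorm (toB6 (geo i) (R₀ i) (H₀ i)) (W i → ℝ))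
    (𝔭 : ∀ i, HolderProbes (geo i) (bg i) (X i) (Y i) (PX i) (PY i))
    (bHY : ∀ i, ℝ → BlockNorm (toB6 (geo i) (R₀ i) (H₀ i)) (Y i → ℝ))
    (ev : ∀ i, (geo i).Loc → X i → ℝ) (evY : ∀ i, (geo i).Loc → Y i → ℝ) {P : ∀ i, (geo i).Loc → Prop}
    (Rel : ∀ i, (geo i).Site → (geo i).Site → Prop) [∀ i, DecidableRel (Rel i)] (m : ℕ)
    (θ₁ θD θH r₁ B₀ δ₀ δK σ c ρ a₁ M₁ ML B₁ δ₁ B₃ δ₃ ρ' α Lc κ₀ : ℝ) (Bε Bh Bi Bq BhD Bx : ℝ → ℝ) (Bεβ Bi2 : ℝ → ℝ → ℝ)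
    (hθ₁ : 0 ≤ θ₁) (hθD : 0 ≤ θD) (hθH : 0 ≤ θH) (hr₁ : 0 ≤ r₁) (hB₀ : 0 ≤ B₀) (hB₃ : 0 ≤ B₃) (hσ : 0 ≤ σ) (hρ' : 0 < ρ') (hρ'ρ : ρ' + 3 * σ ≤ ρ)
    (hρS : ρ ≤ δ₀) (hρ₃ : ρ ≤ δ₃) (hρδ : ρ + σ ≤ δK) (hc : 0 ≤ c) (ha₁ : 0 < a₁) (hM₁ : 0 < M₁) (hδ₁ : 0 < δ₁)
    (hα0 : 0 ≤ α) (hα1 : α < 1) (hBε : ∀ ε, 0 ≤ Bε ε) (hBεβ : ∀ ε β, 0 ≤ Bεβ ε β)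
    (hBh : ∀ β, 0 ≤ β → β < 1 → 0 ≤ Bh β) (hBq : ∀ β, 0 ≤ β → β < 1 → 0 ≤ Bq β) (hBhD : ∀ β, 0 ≤ β → β < 1 → 0 ≤ BhD β)
    (hBx : ∀ β, 0 ≤ β → β < 1 → 0 ≤ Bx β)
    (hgeo : ∀ i, GeoOK (geo i)) (S : ∀ i, ModelSignsOn (geo i) (P i))
    (hL1 : ∀ i, 1 ≤ (geo i).L) (hLle : ∀ i, (geo i).L ≤ Lc) (hη : ∀ i, 0 < (geo i).eta) (hκ : ∀ i, (bH i).κ ≤ κ₀)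
    (hrow : ∀ i, ML ≤ (geo i).M → RowSum (toB6 (geo i) (R₀ i) (H₀ i)) σ c)
    (hL21 : ∀ δ : ℝ, 0 < δ → ∃ ML' c' : ℝ, Lemma21AboveG geo R₀ H₀ δ α ML' c')
    (hsat : ∀ (i : I) (n : Fin 4) (B' δ' : ℝ),
      (∀ a a' b, Rel i a a' → maj342 (geo i) n B' δ' a b = maj342 (geo i) n B' δ' a' b) ∧
      (∀ a b b', Rel i b b' → maj342 (geo i) n B' δ' a b = maj342 (geo i) n B' δ' a b'))
    (hmult : ∀ (i : I) (y' : (geo i).Site), (Finset.univ.filter (fun y'' => Rel i y'' y')).card ≤ m)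
    (hcoR : ∀ (i : I) (U : (bg i).Cfg),
      CoRealizesRel (GG i) 0 U (Rel i) (𝔬 i).blk (𝔬 i).blk (ev i) ((𝔬 i).GG U) ∧
      CoRealizesRel (GG i) 2 U (Rel i) (𝔬 i).blk (𝔬 i).blkY (evY i) ((𝔬 i).GG U ∘ₗ (𝔬 i).Dstar U))
    (hco1R : ∀ (i : I) (U : (bg i).Cfg), CoRealizesRel (GG i) 1 U (Rel i) (𝔬 i).blkY (𝔬 i).blk (ev i) ((𝔬 i).D U ∘ₗ (𝔬 i).GG U))
    (hcoG : ∀ (i : I) (U : (bg i).Cfg),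
      CoReadsGlob (GG i) 0 U (𝔬 i).blk (𝔬 i).blk (ev i) ((𝔬 i).GG U) ∧
      CoReadsGlob (GG i) 1 U (𝔬 i).blkY (𝔬 i).blk (ev i) ((𝔬 i).D U ∘ₗ (𝔬 i).GG U) ∧
      CoReadsGlob (GG i) 2 U (𝔬 i).blk (𝔬 i).blkY (evY i) ((𝔬 i).GG U ∘ₗ (𝔬 i).Dstar U))
    (hsymGG : ∀ (i : I) (U : (bg i).Cfg), IsTransposePair ((𝔬 i).GG U) ((𝔬 i).GG U))
    (htrGG : ∀ (i : I) (U : (bg i).Cfg), IsTransposePair ((𝔬 i).D U ∘ₗ (𝔬 i).GG U) ((𝔬 i).GG U ∘ₗ (𝔬 i).Dstar U))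
    (hl2R : ∀ (i : I) (U : (bg i).Cfg),
      L2ReadsRel (R := R₀ i) (H := H₀ i) (GG i) 0 U (Rel i) (𝔬 i).blk (𝔬 i).blk (ev i) ((𝔬 i).GG U) ∧
      L2ReadsRel (R := R₀ i) (H := H₀ i) (GG i) 1 U (Rel i) (𝔬 i).blkY (𝔬 i).blk (ev i) ((𝔬 i).D U ∘ₗ (𝔬 i).GG U) ∧
      L2ReadsRel (R := R₀ i) (H := H₀ i) (GG i) 2 U (Rel i) (𝔬 i).blk (𝔬 i).blkY (evY i) ((𝔬 i).GG U ∘ₗ (𝔬 i).Dstar U))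
    (hH1R : ∀ (i : I) (U : (bg i).Cfg),
      H1ReadsRel (GG i) U (𝔭 i) (Rel i) (𝔬 i).blk (𝔬 i).blkY (ev i) (evY i) ((𝔬 i).D U ∘ₗ (𝔬 i).GG U)
        ((𝔬 i).GG U ∘ₗ (𝔬 i).Dstar U))
    (hRdist : ∀ (i : I) (a a' b : (geo i).Site), Rel i a a' → (geo i).dist a b = (geo i).dist a' b)
    (hRdist' : ∀ (i : I) (a b b' : (geo i).Site), Rel i b b' → (geo i).dist a b = (geo i).dist a b')
    (hRlen : ∀ (i : I) (a a' : (geo i).Site), Rel i a a' → (geo i).len a = (geo i).len a')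
    (hmodel : ∀ i, M₁ ≤ (geo i).M → ∀ α₀ : ℝ, 0 < α₀ → (geo i).M * α₀ ≤ a₁ →
      ∀ U : (bg i).Cfg, (bg i).Reg335 c35 α₀ U → (bg i).Reg336 c35 α₀ U →
        Thm33G0 (𝔬 i) (R₀ i) (H₀ i) B₀ δ₀ U ∧
        Step (𝔬 i) (R₀ i) (H₀ i) (hgeo i).lenle 1 (θ₁ * ((geo i).M * α₀)) δK U ∧
        Step (𝔬 i) (R₀ i) (H₀ i) (hgeo i).lenle 2 (θ₁ * ((geo i).M * α₀)) δK U ∧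
        FormSmall (𝔬 i) (r₁ * ((geo i).M * α₀)) U ∧ Identities (𝔬 i) U)
    (hleft : ∀ i, M₁ ≤ (geo i).M → ∀ α₀ : ℝ, 0 < α₀ → (geo i).M * α₀ ≤ a₁ →
      ∀ U : (bg i).Cfg, (bg i).Reg335 c35 α₀ U → (bg i).Reg336 c35 α₀ U →
        LeftStep (𝔬 i) (R₀ i) (H₀ i) (hgeo i).lenle B₀ δ₀ (θD * ((geo i).M * α₀)) δK U)
    (hletters : ∀ i, M₁ ≤ (geo i).M → ∀ α₀ : ℝ, 0 < α₀ → (geo i).M * α₀ ≤ a₁ →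
      ∀ U : (bg i).Cfg, (bg i).Reg335 c35 α₀ U → (bg i).Reg336 c35 α₀ U →
        Letters313 (𝔬 i) (R₀ i) (H₀ i) (hgeo i) B₃ δ₃ U)
    (hlettersD : ∀ i, M₁ ≤ (geo i).M → ∀ α₀ : ℝ, 0 < α₀ → (geo i).M * α₀ ≤ a₁ →
      ∀ U : (bg i).Cfg, (bg i).Reg335 c35 α₀ U → (bg i).Reg336 c35 α₀ U →
        Letters313D (𝔬 i) (R₀ i) (H₀ i) (hgeo i) B₃ δ₃ (bH i) U)
    (hG0H : ∀ i, M₁ ≤ (geo i).M → ∀ α₀ : ℝ, 0 < α₀ → (geo i).M * α₀ ≤ a₁ →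
      ∀ U : (bg i).Cfg, (bg i).Reg335 c35 α₀ U → (bg i).Reg336 c35 α₀ U →
        Thm33G0H (𝔬 i) (𝔭 i) (R₀ i) (H₀ i) (bHY i) Bh Bi Bi2 δ₀ U)
    (hstepH : ∀ i, M₁ ≤ (geo i).M → ∀ α₀ : ℝ, 0 < α₀ → (geo i).M * α₀ ≤ a₁ →
      ∀ U : (bg i).Cfg, (bg i).Reg335 c35 α₀ U → (bg i).Reg336 c35 α₀ U →
        StepH (𝔬 i) (𝔭 i) (R₀ i) (H₀ i) (bHY i) (hgeo i).lenle (θH * ((geo i).M * α₀)) δK U)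
    (hLHH : ∀ i, M₁ ≤ (geo i).M → ∀ α₀ : ℝ, 0 < α₀ → (geo i).M * α₀ ≤ a₁ →
      ∀ U : (bg i).Cfg, (bg i).Reg335 c35 α₀ U → (bg i).Reg336 c35 α₀ U →
        LettersHH (𝔬 i) (𝔭 i) (R₀ i) (H₀ i) (hgeo i).lenle Bq δ₃ U)
    (hLH3 : ∀ i, M₁ ≤ (geo i).M → ∀ α₀ : ℝ, 0 < α₀ → (geo i).M * α₀ ≤ a₁ →
      ∀ U : (bg i).Cfg, (bg i).Reg335 c35 α₀ U → (bg i).Reg336 c35 α₀ U →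
        Letters313H (𝔬 i) (𝔭 i) (R₀ i) (H₀ i) (hgeo i).lenle (bH i) BhD Bx δ₃ U)
    (hres : ∀ i, M₁ ≤ (geo i).M → ∀ α₀ : ℝ, 0 < α₀ → (geo i).M * α₀ ≤ a₁ →
      ∀ U : (bg i).Cfg, (bg i).Reg335 c35 α₀ U → (bg i).Reg336 c35 α₀ U →
        (∀ (n : Fin 6), 3 ≤ n.val → ∀ (lam : (geo i).Loc) (h : (geo i).Cut) (y y' : (geo i).Site), (geo i).cutIn h y →
          (geo i).suppIn lam y' →
          (GG i).l2 n U lam h ≤ B₁ * B9.pref6 ((geo i).len y) n * (geo i).cutSup h * Real.exp (-(δ₁ * (geo i).dist y y')) *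
            (geo i).l2Norm lam) ∧
        E4Block (GG i) Bε δ₁ U ∧ H2Block (GG i) Bεβ δ₁ U) :
    B9.Thm313Printed c35 geo bg GG (fun i => HasRWExpOfOps (𝔬 i)) (fun i => PosDefKOfOps (𝔬 i)) := by
  -- the constants of the leaf
  obtain ⟨MLg, cg, hLg⟩ := hL21 ρ' hρ'
  set cg' : ℝ := max cg 0 with hcg'
  have hcg'0 : 0 ≤ cg' := le_max_right _ _
  set a₀ : ℝ := min a₁ (min (2 * (θ₁ * c + 1))⁻¹ (2 * (r₁ + 1))⁻¹) with ha₀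
  set C₂ : ℝ := const313 (2 * B₀) (2 * B₃) B₃ c with hC₂
  set CD : ℝ := constD313 (B₀ + θD * a₁ * (2 * B₀) * c) (θD * a₁) (2 * B₀) (2 * B₃) B₃ (max κ₀ 0) c with hCD
  set Csup : ℝ := max C₂ CD with hCsup
  set CsupR : ℝ := (m : ℝ) * Csup with hCsupR
  set Cgl : ℝ := Csup * cg' * Lc ^ (4 : ℝ) with hCgl
  set Λu : ℝ := Lc ^ (4 : ℝ) with hΛu
  set BL2S : ℝ := (m : ℝ) * m * (Csup * Λu) with hBL2S
  set Bout : ℝ := max (max (max (max CsupR Cgl) B₁) BL2S) 1 with hBout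
  set δout : ℝ := min ((1 - α) * ρ') δ₁ with hδout
  set tH : ℝ := θH * a₁ with htH
  set Cu : ℝ → ℝ := fun β => constH313 (Bh β + tH * (2 * B₀) * c) tH (2 * B₀) (2 * B₃) B₃ (max (BhD β) (Bx β)) (max (Bq β) (Bx β))
    (max κ₀ 1) c with hCu
  set Bβo : ℝ → ℝ := fun β => max ((m : ℝ) * Cu β) 0 with hBβo
  have hBβo0 : ∀ β, 0 ≤ Bβo β := fun β => le_max_right _ _
  have htH0 : 0 ≤ tH := mul_nonneg hθH ha₁.le
  have ha₀pos : 0 < a₀ := lt_min ha₁ (lt_min (inv_pos.mpr (by nlinarith)) (inv_pos.mpr (by linarith)))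
  have hC₂0 : 0 ≤ C₂ := const313_nonneg (by linarith) (by linarith) hB₃ hc
  have hCsup2 : C₂ ≤ Csup := le_max_left _ _
  have hCsupD : CD ≤ Csup := le_max_right _ _
  have hCsup0 : 0 ≤ Csup := hC₂0.trans hCsup2
  have hCsupR0 : 0 ≤ CsupR := mul_nonneg (Nat.cast_nonneg m) hCsup0
  have hBoutS : CsupR ≤ Bout := (((le_max_left _ _).trans (le_max_left _ _)).trans (le_max_left _ _)).trans (le_max_left _ _)
  have hBoutG : Cgl ≤ Bout := (((le_max_right _ _).trans (le_max_left _ _)).trans (le_max_left _ _)).trans (le_max_left _ _)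
  have hBoutB₁ : B₁ ≤ Bout := ((le_max_right _ _).trans (le_max_left _ _)).trans (le_max_left _ _)
  have hBoutL : BL2S ≤ Bout := (le_max_right _ _).trans (le_max_left _ _)
  have hBout0 : 0 ≤ Bout := zero_le_one.trans (le_max_right _ _)
  have h1α : 0 < 1 - α := by linarith
  have hαρ : 0 ≤ α * ρ' := mul_nonneg hα0 hρ'.le
  have hδρ1 : δout ≤ (1 - α) * ρ' := min_le_left _ _
  have hδρ : δout ≤ ρ' := hδρ1.trans (by nlinarith)
  have hδδ₁ : δout ≤ δ₁ := min_le_right _ _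
  refine ⟨max (max M₁ ML) MLg, δout, a₀, Bout, Bβo, Bε, Bεβ, lt_max_of_lt_left (lt_max_of_lt_left hM₁), lt_min (by positivity) hδ₁,
    ha₀pos, zero_lt_one.trans_le (le_max_right _ _), ?_⟩
  intro i hM α₀ hα₀ hMa U hU hU'
  have hM₁i : M₁ ≤ (geo i).M := ((le_max_left _ _).trans (le_max_left _ _)).trans hM
  have hMLi : ML ≤ (geo i).M := ((le_max_right _ _).trans (le_max_left _ _)).trans hM
  have hMLgi : MLg ≤ (geo i).M := (le_max_right _ _).trans hM
  have hMpos : 0 < (geo i).M := hM₁.trans_le hM₁i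
  have hm0 : 0 ≤ (geo i).M * α₀ := (mul_pos hMpos hα₀).le
  have hma₁ : (geo i).M * α₀ ≤ a₁ := hMa.trans (min_le_left _ _)
  have hmθ : (geo i).M * α₀ ≤ (2 * (θ₁ * c + 1))⁻¹ := hMa.trans ((min_le_right _ _).trans (min_le_left _ _))
  have hmr : (geo i).M * α₀ ≤ (2 * (r₁ + 1))⁻¹ := hMa.trans ((min_le_right _ _).trans (min_le_right _ _))
  obtain ⟨h33, hS1, hS2, hF, hI⟩ := hmodel i hM₁i α₀ hα₀ hma₁ U hU hU'
  have hL := hletters i hM₁i α₀ hα₀ hma₁ U hU hU'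
  have hLD := hlettersD i hM₁i α₀ hα₀ hma₁ U hU hU'
  have hLS := hleft i hM₁i α₀ hα₀ hma₁ U hU hU'
  obtain ⟨hl345, h344, h345⟩ := hres i hM₁i α₀ hα₀ hma₁ U hU hU'
  have hH0 := hG0H i hM₁i α₀ hα₀ hma₁ U hU hU'
  have hStH := hstepH i hM₁i α₀ hα₀ hma₁ U hU hU'
  have hHH := hLHH i hM₁i α₀ hα₀ hma₁ U hU hU'
  have hH3 := hLH3 i hM₁i α₀ hα₀ hma₁ U hU hU'
  have hH1 := hH1R i U
  obtain ⟨hlR0, hlR1, hlR2⟩ := hl2R i U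
  have hrowi := hrow i hMLi
  obtain ⟨h260, hrowg, hsize⟩ := hLg i hMLgi
  have hrowg' : RowSum (toB6 (geo i) (R₀ i) (H₀ i)) ((1 - α) * ρ') cg' := fun y => (hrowg y).trans (le_max_left _ _)
  set θ : ℝ := θ₁ * ((geo i).M * α₀) with hθdef
  set θ' : ℝ := θD * ((geo i).M * α₀) with hθ'def
  have hθ : 0 ≤ θ := mul_nonneg hθ₁ hm0
  have hθ' : 0 ≤ θ' := mul_nonneg hθD hm0
  have hq : θ * c ≤ 1 / 2 := by
    have h := small_aux₇ (mul_nonneg hθ₁ hc) hmθ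
    calc θ * c = θ₁ * c * ((geo i).M * α₀) := by rw [hθdef]; ring
      _ ≤ 1 / 2 := h
  have hq1 : θ * c < 1 := lt_one_of_le_half hq
  have hr : r₁ * ((geo i).M * α₀) < 1 := by
    have h := small_aux₇ hr₁ hmr
    linarith
  have hσδ : σ ≤ δK := by linarith
  have hinv0 : 0 ≤ (1 - θ * c)⁻¹ := inv_nonneg.mpr (by linarith)
  have hA₁ : 0 ≤ B₀ * (1 - θ * c)⁻¹ := mul_nonneg hB₀ hinv0
  have hA₃ : 0 ≤ B₃ * (1 - θ * c)⁻¹ := mul_nonneg hB₃ hinv0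
  have hA₁le : B₀ * (1 - θ * c)⁻¹ ≤ 2 * B₀ := const_le_two_mul hB₀ hq
  have hA₃le : B₃ * (1 - θ * c)⁻¹ ≤ 2 * B₃ := const_le_two_mul hB₃ hq
  have hC0 : 0 ≤ const313 (B₀ * (1 - θ * c)⁻¹) (B₃ * (1 - θ * c)⁻¹) B₃ c := const313_nonneg hA₁ hA₃ hB₃ hc
  have hCle : const313 (B₀ * (1 - θ * c)⁻¹) (B₃ * (1 - θ * c)⁻¹) B₃ c ≤ Csup :=
    (const313_mono hA₁ hA₁le hA₃ hA₃le hB₃ hc).trans hCsup2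
  -- the constant of the left entry
  have hCL : 0 ≤ B₀ + θ' * (B₀ * (1 - θ * c)⁻¹) * c := add_nonneg hB₀ (mul_nonneg (mul_nonneg hθ' hA₁) hc)
  have hθ'le : θ' ≤ θD * a₁ := mul_le_mul_of_nonneg_left hma₁ hθD
  have hCLle : B₀ + θ' * (B₀ * (1 - θ * c)⁻¹) * c ≤ B₀ + θD * a₁ * (2 * B₀) * c := by
    have h2 : θ' * (B₀ * (1 - θ * c)⁻¹) ≤ θD * a₁ * (2 * B₀) := mul_le_mul hθ'le hA₁le hA₁ (mul_nonneg hθD ha₁.le)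
    have h3 : θ' * (B₀ * (1 - θ * c)⁻¹) * c ≤ θD * a₁ * (2 * B₀) * c := mul_le_mul_of_nonneg_right h2 hc
    linarith
  have hD0 : 0 ≤ constD313 (B₀ + θ' * (B₀ * (1 - θ * c)⁻¹) * c) θ' (B₀ * (1 - θ * c)⁻¹) (B₃ * (1 - θ * c)⁻¹) B₃ (bH i).κ c :=
    constD313_nonneg hCL hθ' hA₁ hA₃ hB₃ (bH i).κ_nonneg hc
  have hDle : constD313 (B₀ + θ' * (B₀ * (1 - θ * c)⁻¹) * c) θ' (B₀ * (1 - θ * c)⁻¹) (B₃ * (1 - θ * c)⁻¹) B₃ (bH i).κ c ≤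
      Csup :=
    (constD313_mono hCLle hθ' hθ'le hA₁ hA₁le hA₃ hA₃le hB₃ ((hκ i).trans (le_max_left _ _)) hc).trans hCsupD
  obtain ⟨hco0, hco2⟩ := hcoR i U
  have hco1i := hco1R i U
  obtain ⟨hg0, hg1, hg2⟩ := hcoG i U
  have hlen := (hgeo i).lenle
  -- the model majorants of 𝔊 at the rate ρ′
  have hm0 := GG_entry0_of_letters (hgeo i) hrowi hc hθ hB₀ hB₃ hσ hρ'.le hρ'ρ hρS hρ₃ hρδ hq1 hS2.step1 h33.e0 hL hI
  have hm1 := GG_entry1_of_letters (hgeo i) hrowi hc hθ hθ' hB₀ hB₃ hσ hρ'.le hρ'ρ hρS hρ₃ hρδ hq1 hS2.step1 h33.e0 hLS hL hLD hI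
  have hm2 := GG_entry2_of_letters (hgeo i) hrowi hc hθ hB₀ hB₃ hσ hρ'.le hρ'ρ hρS hρ₃ hρδ hq1 hS1.step1 h33.e2 hL hI
  -- the same majorants in the `maj342 · n Csup ρ′` shape, for the (3.47) passage on the model lattice
  have hM0 : HasMajorantHom (g := toB6 (geo i) (R₀ i) (H₀ i)) (𝔬 i).blk (𝔬 i).blk ((𝔬 i).GG U) (maj342 (geo i) 0 Csup ρ') :=
    hasMajorantHom_maj342_zero_of_le ((hasMajorantHom_iff (g := toB6 (geo i) (R₀ i) (H₀ i)) (𝔬 i).blk _ _).2 hm0) hCle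
  have hM1 : HasMajorantHom (g := toB6 (geo i) (R₀ i) (H₀ i)) (𝔬 i).blk (𝔬 i).blkY ((𝔬 i).D U ∘ₗ (𝔬 i).GG U) (maj342 (geo i) 1 Csup ρ') :=
    hasMajorantHom_maj342_one_of_le hm1 hDle hlen
  have hM2 : HasMajorantHom (g := toB6 (geo i) (R₀ i) (H₀ i)) (𝔬 i).blkY (𝔬 i).blk ((𝔬 i).GG U ∘ₗ (𝔬 i).Dstar U) (maj342 (geo i) 2 Csup ρ') :=
    hasMajorantHom_maj342_two_of_le hm2 hCle hlen
  -- the proved clauses (3.42)₁,₂,₃ of 𝔊 at the rate ρ′ with the constant m·Csup, through the RELATIVE co-readings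
  have cl0 : Clause342 (GG i) 0 CsupR ρ' U :=
    clause342_of_hasMajorantHom_rel hco0 hCsup0 hlen (hsat i 0 Csup ρ').1 (hsat i 0 Csup ρ').2 (hmult i) hM0
  have cl1 : Clause342 (GG i) 1 CsupR ρ' U :=
    clause342_of_hasMajorantHom_rel hco1i hCsup0 hlen (hsat i 1 Csup ρ').1 (hsat i 1 Csup ρ').2 (hmult i) hM1
  have cl2 : Clause342 (GG i) 2 CsupR ρ' U :=
    clause342_of_hasMajorantHom_rel hco2 hCsup0 hlen (hsat i 2 Csup ρ').1 (hsat i 2 Csup ρ').2 (hmult i) hM2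
  -- the global entries (3.47)₀,₁,₂ of 𝔊, constant Csup·c′·L⁴ ≦ Bout
  have hL0i : 0 < (geo i).L := lt_of_lt_of_le one_pos (hL1 i)
  have hL4 : (geo i).L ^ (4 : ℝ) ≤ Lc ^ (4 : ℝ) := Real.rpow_le_rpow hL0i.le (hLle i) (by norm_num)
  have hCgl0 : 0 ≤ Csup * cg' * (geo i).L ^ (4 : ℝ) := mul_nonneg (mul_nonneg hCsup0 hcg'0) (Real.rpow_nonneg hL0i.le _)
  have hCglle : Csup * cg' * (geo i).L ^ (4 : ℝ) ≤ Bout := (mul_le_mul_of_nonneg_left hL4 (mul_nonneg hCsup0 hcg'0)).trans hBoutG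
  have hglob : ∀ (n : Fin 4) (lam : (geo i).Loc) (γ : ℝ), n ≠ 3 → -4 ≤ γ → γ ≤ 4 →
      (GG i).glob n U lam γ ≤ Bout * (geo i).wNorm γ lam :=
    glob_noLap_of_entries (PG := fun _ => True) (S i) hCgl0 hCgl0 hCgl0 hCglle hCglle hCglle
      (fun lam γ _ => glob_of_hasMajorantHom hg0 hM0 hCsup0 hcg'0 (hL1 i) (hη i) (S i).wNorm_nonneg hsize h260 hrowg' lam γ)
      (fun lam γ _ => glob_of_hasMajorantHom hg1 hM1 hCsup0 hcg'0 (hL1 i) (hη i) (S i).wNorm_nonneg hsize h260 hrowg' lam γ)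
      (fun lam γ _ => glob_of_hasMajorantHom hg2 hM2 hCsup0 hcg'0 (hL1 i) (hη i) (S i).wNorm_nonneg hsize h260 hrowg' lam γ)
      (fun _ _ _ h => absurd trivial h)
  -- everything brought to (Bout, δout)
  have w : ∀ {j : Fin 4}, Clause342 (GG i) j CsupR ρ' U → Clause342 (GG i) j Bout δout U := fun cm =>
    clause342_mono cm hCsupR0 hBoutS hδρ (S i).dist_nonneg hlen (S i).supNorm_nonneg
  -- the L² lines (3.46)₀,₁,₂ of 𝔊 by the Schur test from the three sup majorants, the transposition letters and the scale transfer
  have hm00 : (0 : ℝ) ≤ m := Nat.cast_nonneg m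
  have hΛu0 : 0 ≤ Λu := Real.rpow_nonneg (hL0i.le.trans (hLle i)) _
  have hST : ∀ γ : ℝ, |γ| ≤ 4 → ScaleTransfer (geo i) ρ' α ((geo i).L ^ |γ|) (fun y => (geo i).len y ^ γ) ∧
      0 ≤ (geo i).L ^ |γ| ∧ (geo i).L ^ |γ| ≤ Λu := fun γ hγ =>
    ⟨scaleTransfer_rpow_of_260 h260 hsize (hL1 i) (hη i) γ hγ, Real.rpow_nonneg hL0i.le _,
      (B9Ineq347AllEntries.size_condition_compact (geo i).L γ _ (hL1 i) hγ hsize).2.trans hL4⟩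
  obtain ⟨hST1, hΛ₁0, hΛ₁le⟩ := hST 1 (by norm_num)
  obtain ⟨hSTh, hΛh0, hΛhle⟩ := hST (1 / 2) (by rw [abs_of_nonneg (by norm_num : (0 : ℝ) ≤ 1 / 2)]; norm_num)
  have hb0 := l2bd_entry0_of_sup (R₀ := R₀ i) (H₀ := H₀ i) (hgeo i) hC0 hST1 hm0 (hsymGG i U)
  have hm1' : HasMajorantHom (g := toB6 (geo i) (R₀ i) (H₀ i)) (𝔬 i).blk (𝔬 i).blkY ((𝔬 i).D U ∘ₗ (𝔬 i).GG U)
      (fun (a b : (geo i).Site) => Csup * (geo i).len a * Real.exp (-(ρ' * (geo i).dist a b))) :=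
    hasMajorantHom_mono (g := toB6 (geo i) (R₀ i) (H₀ i)) (𝔬 i).blk (𝔬 i).blkY hm1 fun a b =>
      mul_le_mul_of_nonneg_right (mul_le_mul_of_nonneg_right hDle (hlen a)) (Real.exp_nonneg _)
  have hm2' : HasMajorantHom (g := toB6 (geo i) (R₀ i) (H₀ i)) (𝔬 i).blkY (𝔬 i).blk ((𝔬 i).GG U ∘ₗ (𝔬 i).Dstar U)
      (fun (a b : (geo i).Site) => Csup * (geo i).len a * Real.exp (-(ρ' * (geo i).dist a b))) :=
    hasMajorantHom_mono (g := toB6 (geo i) (R₀ i) (H₀ i)) (𝔬 i).blkY (𝔬 i).blk hm2 fun a b =>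
      mul_le_mul_of_nonneg_right (mul_le_mul_of_nonneg_right hCle (hlen a)) (Real.exp_nonneg _)
  obtain ⟨hb1, hb2⟩ := l2bd_entry12_of_sup (R₀ := R₀ i) (H₀ := H₀ i) (hgeo i) hCsup0 hSTh hm1' hm2' (htrGG i U)
  have hexp : ∀ y y' : (geo i).Site, Real.exp (-((1 - α) * ρ' * (geo i).dist y y')) ≤ Real.exp (-(δout * (geo i).dist y y')) :=
    fun y y' => Real.exp_le_exp.mpr (neg_le_neg (mul_le_mul_of_nonneg_right hδρ1 ((S i).dist_nonneg y y')))
  have hKL0 : 0 ≤ Csup * Λu := mul_nonneg hCsup0 hΛu0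
  have hK0le : const313 (B₀ * (1 - θ * c)⁻¹) (B₃ * (1 - θ * c)⁻¹) B₃ c * (geo i).L ^ |(1 : ℝ)| ≤ Csup * Λu :=
    mul_le_mul hCle hΛ₁le hΛ₁0 hCsup0
  have hKhle : Csup * (geo i).L ^ |(1 / 2 : ℝ)| ≤ Csup * Λu := mul_le_mul_of_nonneg_left hΛhle hCsup0
  have hP : ∀ t : ℝ, B9.pref6 t 0 = t ^ 2 ∧ B9.pref6 t 1 = t ∧ B9.pref6 t 2 = t := fun t => by simp [B9.pref6]
  have hB0 : BlockBd (g := toB6 (geo i) (R₀ i) (H₀ i)) (𝔬 i).blk (𝔬 i).blk ((𝔬 i).GG U)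
      (fun (y y' : (geo i).Site) => Csup * Λu * B9.pref6 ((geo i).len y) 0 * Real.exp (-(δout * (geo i).dist y y'))) := by
    refine hb0.mono fun y y' => ?_
    rw [(hP ((geo i).len y)).1]
    calc const313 (B₀ * (1 - θ * c)⁻¹) (B₃ * (1 - θ * c)⁻¹) B₃ c * (geo i).L ^ |(1 : ℝ)| * (geo i).len y ^ 2 *
          Real.exp (-((1 - α) * ρ' * (geo i).dist y y'))
        ≤ Csup * Λu * (geo i).len y ^ 2 * Real.exp (-((1 - α) * ρ' * (geo i).dist y y')) :=
          mul_le_mul_of_nonneg_right (mul_le_mul_of_nonneg_right hK0le (sq_nonneg _)) (Real.exp_nonneg _)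
      _ ≤ Csup * Λu * (geo i).len y ^ 2 * Real.exp (-(δout * (geo i).dist y y')) :=
          mul_le_mul_of_nonneg_left (hexp y y') (mul_nonneg hKL0 (sq_nonneg _))
  have hB1 : BlockBd (g := toB6 (geo i) (R₀ i) (H₀ i)) (𝔬 i).blk (𝔬 i).blkY ((𝔬 i).D U ∘ₗ (𝔬 i).GG U)
      (fun (y y' : (geo i).Site) => Csup * Λu * B9.pref6 ((geo i).len y) 1 * Real.exp (-(δout * (geo i).dist y y'))) := by
    refine hb1.mono fun y y' => ?_
    rw [(hP ((geo i).len y)).2.1]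
    calc Csup * (geo i).L ^ |(1 / 2 : ℝ)| * (geo i).len y * Real.exp (-((1 - α) * ρ' * (geo i).dist y y'))
        ≤ Csup * Λu * (geo i).len y * Real.exp (-((1 - α) * ρ' * (geo i).dist y y')) :=
          mul_le_mul_of_nonneg_right (mul_le_mul_of_nonneg_right hKhle (hlen y)) (Real.exp_nonneg _)
      _ ≤ Csup * Λu * (geo i).len y * Real.exp (-(δout * (geo i).dist y y')) :=
          mul_le_mul_of_nonneg_left (hexp y y') (mul_nonneg hKL0 (hlen y))
  have hB2 : BlockBd (g := toB6 (geo i) (R₀ i) (H₀ i)) (𝔬 i).blkY (𝔬 i).blk ((𝔬 i).GG U ∘ₗ (𝔬 i).Dstar U)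
      (fun (y y' : (geo i).Site) => Csup * Λu * B9.pref6 ((geo i).len y) 2 * Real.exp (-(δout * (geo i).dist y y'))) := by
    refine hb2.mono fun y y' => ?_
    rw [(hP ((geo i).len y)).2.2]
    calc Csup * (geo i).L ^ |(1 / 2 : ℝ)| * (geo i).len y * Real.exp (-((1 - α) * ρ' * (geo i).dist y y'))
        ≤ Csup * Λu * (geo i).len y * Real.exp (-((1 - α) * ρ' * (geo i).dist y y')) :=
          mul_le_mul_of_nonneg_right (mul_le_mul_of_nonneg_right hKhle (hlen y)) (Real.exp_nonneg _)
      _ ≤ Csup * Λu * (geo i).len y * Real.exp (-(δout * (geo i).dist y y')) :=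
          mul_le_mul_of_nonneg_left (hexp y y') (mul_nonneg hKL0 (hlen y))
  have hl0 := l2line_of_blockBd_rel hlR0 (hRlen i) (hRdist i) (hRdist' i) (hmult i) hKL0 hlen hB0
  have hl1 := l2line_of_blockBd_rel hlR1 (hRlen i) (hRdist i) (hRdist' i) (hmult i) hKL0 hlen hB1
  have hl2 := l2line_of_blockBd_rel hlR2 (hRlen i) (hRdist i) (hRdist' i) (hmult i) hKL0 hlen hB2
  -- everything brought to (Bout, δout)
  have w5 : ∀ {n : Fin 6} {b δ : ℝ}, b ≤ Bout → δout ≤ δ →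
      (∀ (lam : (geo i).Loc) (h : (geo i).Cut) (y y' : (geo i).Site), (geo i).cutIn h y → (geo i).suppIn lam y' →
        (GG i).l2 n U lam h ≤ b * B9.pref6 ((geo i).len y) n * (geo i).cutSup h * Real.exp (-(δ * (geo i).dist y y')) *
          (geo i).l2Norm lam) →
      ∀ (lam : (geo i).Loc) (h : (geo i).Cut) (y y' : (geo i).Site), (geo i).cutIn h y → (geo i).suppIn lam y' →
        (GG i).l2 n U lam h ≤ Bout * B9.pref6 ((geo i).len y) n * (geo i).cutSup h * Real.exp (-(δout * (geo i).dist y y')) *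
          (geo i).l2Norm lam := by
    intro n b δ hb hδ h lam hc y y' hcut hs
    exact weaken5 (h lam hc y y' hcut hs) hb hBout0 (pref6_nonneg (hlen y) n) ((S i).cutSup_nonneg hc) ((S i).l2Norm_nonneg lam)
      hδ ((S i).dist_nonneg y y')
  have hl2B : L2Block (GG i) Bout δout U :=
    l2Block_of_split' (w5 hBoutL le_rfl hl0) (w5 hBoutL le_rfl hl1) (w5 hBoutL le_rfl hl2)
      (fun n hn => w5 hBoutB₁ hδδ₁ (hl345 n hn))
  -- the (3.43) line of 𝔊 from the two probe majorants of (3.153) and the relative probe co-reading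
  set θH' : ℝ := θH * ((geo i).M * α₀) with hθH'def
  have hθH' : 0 ≤ θH' := mul_nonneg hθH (mul_pos hMpos hα₀).le
  have hθH'le : θH' ≤ tH := mul_le_mul_of_nonneg_left hma₁ hθH
  have hκi : (bH i).κ ≤ max κ₀ 1 := (hκ i).trans (le_max_left _ _)
  have h1κ : (1 : ℝ) ≤ max κ₀ 1 := le_max_right _ _
  have hCuL : ∀ β, 0 ≤ β → β < 1 →
      constH313 (Bh β + θH' * (B₀ * (1 - θ * c)⁻¹) * c) θH' (B₀ * (1 - θ * c)⁻¹) (B₃ * (1 - θ * c)⁻¹) B₃ (BhD β) (Bq β) (bH i).κ c ≤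
        Cu β := by
    intro β h0 h1
    have hCL : Bh β + θH' * (B₀ * (1 - θ * c)⁻¹) * c ≤ Bh β + tH * (2 * B₀) * c := by
      have := mul_le_mul_of_nonneg_right (mul_le_mul hθH'le hA₁le hA₁ htH0) hc; linarith
    exact constH313_mono' hCL hθH' hθH'le hA₁ hA₁le hA₃ hA₃le hB₃ (hBhD β h0 h1) (le_max_left _ _) (hBq β h0 h1) (le_max_left _ _)
      (bH i).κ_nonneg hκi hc
  have hCuR : ∀ β, 0 ≤ β → β < 1 →
      constH313 (Bh β + θH' * (B₀ * (1 - θ * c)⁻¹) * c) θH' (B₀ * (1 - θ * c)⁻¹) (B₃ * (1 - θ * c)⁻¹) B₃ (Bx β) (Bx β) 1 c ≤ Cu β := by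
    intro β h0 h1
    have hCL : Bh β + θH' * (B₀ * (1 - θ * c)⁻¹) * c ≤ Bh β + tH * (2 * B₀) * c := by
      have := mul_le_mul_of_nonneg_right (mul_le_mul hθH'le hA₁le hA₁ htH0) hc; linarith
    exact constH313_mono' hCL hθH' hθH'le hA₁ hA₁le hA₃ hA₃le hB₃ (hBx β h0 h1) (le_max_right _ _) (hBx β h0 h1) (le_max_right _ _)
      zero_le_one h1κ hc
  have hCu0 : ∀ β, 0 ≤ β → β < 1 → 0 ≤ Cu β := fun β h0 h1 =>
    (constH313_nonneg (add_nonneg (hBh β h0 h1) (mul_nonneg (mul_nonneg hθH' hA₁) hc)) hθH' hA₁ hA₃ hB₃ (hBx β h0 h1) (hBx β h0 h1)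
      zero_le_one hc).trans (hCuR β h0 h1)
  have hL43 : ∀ β, 0 ≤ β → β < 1 → HasMajorantHom (g := toB6 (geo i) (R₀ i) (H₀ i)) (𝔬 i).blk (𝔭 i).blkPY
      ((𝔭 i).ΦY U β ∘ₗ ((𝔬 i).D U ∘ₗ (𝔬 i).GG U))
      (fun (a b : (geo i).Site) => Cu β * (geo i).len a ^ (1 - β) * Real.exp (-(ρ' * (geo i).dist a b))) := by
    intro β h0 h1
    have h := GG_probe43L_of_letters (hgeo i) (𝔭 i) hrowi hc hθ hθH' hB₀ hB₃ (hBh β h0 h1) (hBq β h0 h1) (hBhD β h0 h1) hσ hρ'.le hρ'ρ hρS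
      hρ₃ hρδ hq1 hS2.step1 h33.e0 (hH0.h43L β h0 h1) (hStH.pY1 β h0 h1) (hHH.pQ β h0 h1) (hH3.pYDH β h0 h1) hL hLD.rgdH hI
    exact hasMajorantHom_mono (g := toB6 (geo i) (R₀ i) (H₀ i)) (𝔬 i).blk (𝔭 i).blkPY h fun a b =>
      mul_le_mul_of_nonneg_right (mul_le_mul_of_nonneg_right (hCuL β h0 h1) (Real.rpow_nonneg (hlen a) _)) (Real.exp_nonneg _)
  have hR43 : ∀ β, 0 ≤ β → β < 1 → HasMajorantHom (g := toB6 (geo i) (R₀ i) (H₀ i)) (𝔬 i).blkY (𝔭 i).blkPX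
      ((𝔭 i).ΦX U β ∘ₗ ((𝔬 i).GG U ∘ₗ (𝔬 i).Dstar U))
      (fun (a b : (geo i).Site) => Cu β * (geo i).len a ^ (1 - β) * Real.exp (-(ρ' * (geo i).dist a b))) := by
    intro β h0 h1
    have h := GG_probe43R_of_letters (hgeo i) (𝔭 i) hrowi hc hθ hθH' hB₀ hB₃ (hBh β h0 h1) (hBx β h0 h1) hσ hρ'.le hρ'ρ hρS hρ₃ hρδ hq1
      hS1.step1 h33.e2 (hH0.h43R β h0 h1) (hStH.pX1 β h0 h1) (hH3.pXDv β h0 h1) (hH3.pXQs β h0 h1) hL hI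
    exact hasMajorantHom_mono (g := toB6 (geo i) (R₀ i) (H₀ i)) (𝔬 i).blkY (𝔭 i).blkPX h fun a b =>
      mul_le_mul_of_nonneg_right (mul_le_mul_of_nonneg_right (hCuR β h0 h1) (Real.rpow_nonneg (hlen a) _)) (Real.exp_nonneg _)
  have h343 : H1Block (GG i) (fun β => m * Cu β) ρ' U :=
    line343_of_hasMajorantHom_rel (R := R₀ i) (H := H₀ i) hH1 (hRlen i) (hRdist i) (hRdist' i) (hmult i) hCu0 hlen hL43 hR43
  have hβle : ∀ β, (m : ℝ) * Cu β ≤ Bβo β := fun β => le_max_left _ _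
  exact ⟨⟨eNoLap_of_clauses (w cl0) (w cl1) (w cl2), hl2B, hglob⟩,
    ⟨h1Block_mono (S i) h343 hβle hBβo0 hδρ, e4Block_mono (S i) h344 (fun _ => le_rfl) hBε hδδ₁,
      h2Block_mono (S i) h345 (fun _ _ => le_rfl) hBεβ hδδ₁⟩,
    hasRWExp_of_schemas (hgeo i) hrowi hθ hσδ hq1 hS2 hI (GG i) δout, posDefK_of_schemas hr hF hI (GG i)⟩

end Family

end

end Literature.MathematicalPhysics.QuantumFieldTheory.Balaban1983to89.B9Thm313WholeLeafRelSH
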